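import Summits.QuantumFields.YangMills.Theorems.BalabanUVNodesN12Thm1LettersAtLengthOfK0GridGB
import Summits.QuantumFields.YangMills.Theorems.BalabanUVNodesK0Stub1BHolds
import HarnessLib

/-!
# BalabanUVNodes ∕ N12 — THE (8)-LETTER OF N12's (J0′) ROW AT THE INSTANCE's LENGTH, AT PRINT's [II] (2.3) DATUM, IS INHABITED — HYPOTHESIS-FREE (from K0⁷'s V23 stub-1ᴮ text by name,
# `K0Stub1BHolds.prop8StepCoPGridGBAt_holds`) ([Balaban1985Variational] Thm 1 (8) p.279, Prop. 8 p.304; [Balaban1984PropagatorsII] (2.3) p.224; [Balaban1988Convergent] (2.1) p.254,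
# (2.12) p.256, (2.18) p.257; [Balaban1985RegularSpaces] (1.3)–(1.6) p.77; [Balaban1987RG1] (0.1) p.251; [Balaban1989LargeFieldI] (1.74) p.192, Prop. 1 p.194)

Cell `pub-ymgap` (HUMAN RULINGS D-0062 ∕ D-0149), seat `pub-ymgap-dag-n12-d` g32 (R134 N12 [B15] s2 = by-name knit at the record; count-neutral helper of K1⁹ `stmt-QuantumFields-27364`,
`--kind proof --supports … --as helper`).  THEOREMS ONLY (0 `def`, 0 `instance`, 0 `sorry`); one-term compositions BY NAME.  IMPORT POLICY: this module imports `…K0Stub1BHolds`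
(⟶ `…K0V23Defs` ⟶ N07's junction files), which sit in the Stage-2 seam's cone (`Node00/Record13CoP`; def-R `red_v3.txt`, transiently unbuildable between the 13:30Z 08-30 seam edit
and the consolidated re-feed, green at both ends — `red_end_v4.txt` has no member of the closure); the seam-free content lives in `…N12Thm1LettersAtLengthOfK0GridGB` (✓, this seat).

WHAT.  The green sibling `…N12Thm1LettersAtLengthOfK0GridGB` serves the at-length (8)-letter of N12's (J0′) row (dag-n12-c's `h15T` binder of
`B15Prop1Thm1RowsOfExistsUniqueAtLengthB.thm1Rows_atZ_of_thm1TorusClass_existsUnique_atLengthB`, over a bond-datum family `bd (k) ·` and the record's (7) row) from the BODY of K0⁷'s V23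
stub-1ᴮ text.  HERE: (§1) the same BY NAME from `K0V23Defs.Prop8StepCoPGridGBAt F` (one-liners), and (§2) HYPOTHESIS-FREE — dag-n07-e's ★★★★ `K0Stub1BHolds.prop8StepCoPGridGBAt_holds F`
(the S1c chain's end-to-end theorem `exists_prop8RegSepTopStepGB_lam F 1 le_rfl`, ✓p767364) discharges the stub text at every family `F`: ∃ constants `(c, c₀, c₁, B₃, a₀, a₁)` with
`2L² ≤ B₃`, `0 < a₀`, `0 < a₁` such that, at every `(ν, Kt, k)` passing K0⁷'s grid guard `A‴` (`c ≤ ν.M₁`, `k + c₀ ≤ m + Kt`, `L^{c₁} ∣ ν.M₁`, `LᵏM₁ ∣ sitesPerDir 0`), [15] Theorem 1's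
(8) holds for every `Λ`-minimiser (`IsMinimizerB … (Node00.lamDatum F Kt k s.Ω) W U₀`, print's [II] (2.3) datum) over class (6) at `ε₀` on the support of record, for data `W` with the
record's (7) row `Node00.Sect2.DataSmall7PTop` (§2 ★★★★ `exists_thm1LetterT_atLength_lamDatum_pTop_inhabited`) resp. print's (7) row `Node00.dataSmall7LamTopOf F 2` (★★★
`exists_thm1LetterT_atLength_lamDatum_inhabited`) — THE FIRST PRODUCER, IN THE TREE, OF A [15]-THEOREM-1 LETTER OF N12's (J0′) ROW AT PRINT's DATUM (the seat's g31
`…N12Thm1NamesBInhabitedAtGridGuardLam` gave the house-shape NAME inhabited; it sits on the V22 closure and becomes residue with the seam).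

HONEST FRAMING ∕ LOCATED.  One-term compositions of landed theorems; the mathematics is dag-n07-e's S1c chain (N07's [15] Prop. 8 road at print's datum) and k0-s1-w1's 53′; the (E∕U)
letter `h15EUT` of the same row has NO producer at any datum (orphan edge N07→N12) and is NOT touched here; the instances served are exactly those passing `A‴` (the K0 road's guard —
dag-n12-d g29's `…N12JunctionHeightCeiling` locates which heights that reaches); K0⁷ V23 is NOT registered by this file and K0⁷ is NOT closed (stub 3ᴬ′ᴮ, the seam `hseam`); N12 NOT
discharged (its junction of record displays MORE than this letter: (E∕U), the LF∕window∕cap rows, the [B16] Prop. 1 carrier); counts unmoved (typed 28∕28 · discharged 8∕27, A 8∕28;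
K 1∕4); R4 closes only the conditional finite-𝕋⁴ rung `BalabanLadder.UV` at fixed `ε = L^(−K)`; no summit statement is proved here and NOT the Yang–Mills mass gap (Clay); nothing
continuum ∕ ℝ⁴ ∕ OS.
-/

noncomputable section

namespace Summit.QuantumFields.YangMills.BalabanUVNodes.N12Thm1LetterAtLengthLamDatumInhabited

open scoped Matrix.Norms.L2Operator
open Literature.MathematicalPhysics.QuantumFieldTheory.Balaban1983to89
open T4Continuum B15DeterminingSets GaugeField B15Prop1Carrier
open B15DeterminingSetsB (BDetSet IsMinimizerB AgreeOnB)
open B14.Eq213MaximalDomains (side)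
open T4CubeChartGnomonic (SU2)
open Node00 (Stage7Numerics lamDatum suppDomOfRecord dataSmall7LamTopOf)
open Summit.QuantumFields.YangMills.Theorems.K0V23Defs (Prop8StepCoPGridGBAt)
open Summit.QuantumFields.YangMills.BalabanUVNodes.K0Stub1BHolds (prop8StepCoPGridGBAt_holds)
open Summit.QuantumFields.YangMills.BalabanUVNodes.N12Thm1LettersAtLengthOfK0GridGB (exists_thm1LetterT_atLength_lamDatum_of_prop8StepCoPGridGB
  exists_thm1LetterT_atLength_lamDatum_pTop_of_prop8StepCoPGridGB)

variable {F : T4Family}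

/-! ## §1  By name from K0⁷'s V23 stub-1ᴮ text -/

/-- ★★ **THE AT-LENGTH (8)-LETTER AT PRINT's DATUM FROM K0⁷'s V23 STUB-1ᴮ TEXT BY NAME** (`K0V23Defs.Prop8StepCoPGridGBAt F`, print's (7) row `Node00.dataSmall7LamTopOf F 2`):
`…N12Thm1LettersAtLengthOfK0GridGB.exists_thm1LetterT_atLength_lamDatum_of_prop8StepCoPGridGB` at the text (definitional unfolding).  CONDITIONAL on the text as a hypothesis (§2
discharges it). [cite: Balaban1985Variational, Thm 1 (6)–(8) pp.278–279, Prop. 8 p.304, p.304 lines 1–2; Balaban1984PropagatorsII, (2.3) p.224; Balaban1985RegularSpaces, (1.3)–(1.6) p.77; Balaban1988Convergent, (2.1) p.254, (2.5) p.255, (2.12) p.256, (2.17)–(2.18) p.257; Balaban1987RG1, (0.1) p.251] -/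
theorem exists_thm1LetterT_atLength_lamDatum_of_prop8StepCoPGridGBAt (h1 : Prop8StepCoPGridGBAt F) :
    ∃ (c c₀ c₁ : ℕ) (B₃ a₀ a₁ : ℝ), 2 * (F.L : ℝ) ^ 2 ≤ B₃ ∧ 0 < a₀ ∧ 0 < a₁ ∧
    ∀ (ν : Stage7Numerics) (Kt k : ℕ), c ≤ ν.M₁ → k + c₀ ≤ F.m + Kt → F.L ^ c₁ ∣ ν.M₁ → side (F.P Kt).L ν.M₁ k ∣ (F.P Kt).sitesPerDir 0 →
    ∀ (s : B14.Eq218Concrete.Seq (fun n : ℕ => Node00.unionsOfCubes (F.P Kt) (side (F.P Kt).L ν.M₁ n)) k),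
      Node00.Sect2.SeqSeparated ν.M₁ s → 0 < ν.M₁ →
      ∀ (ε₀ : ℝ) (δ : ℕ → ℝ), (∀ j, j ≤ k → 0 < δ j ∧ δ j ≤ a₁ ∧ B₃ * δ j ≤ ε₀) → (∀ j, j < k → δ j ≤ 2 * δ (j + 1)) →
      (∀ j, j < k → δ (j + 1) ≤ 2 * δ j) → ε₀ ≤ a₀ →
      ∀ W : MSField (F.P Kt) SU2, dataSmall7LamTopOf F 2 Kt s.Ω (suppDomOfRecord F ν Kt s.Ω) k δ W →
        ∀ U₀ : GaugeField (F.P Kt) 0 SU2, IsMinimizerB (Node00.avOfRecord F 2 Kt)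
            {U | (∀ j, j ≤ k → PlaqSmallOn (Node00.Sect2.omegaPlaqsTop s.Ω (suppDomOfRecord F ν Kt s.Ω) j) (ε₀ * (F.P Kt).eta j ^ 2) U) ∧
              Node00.Sect2.CoDivClassOnTop s.Ω (suppDomOfRecord F ν Kt s.Ω) k ε₀ U}
            (lamDatum F Kt k s.Ω) W U₀ →
          (∀ j, j ≤ k → PlaqSmallOn (Node00.Sect2.omegaPlaqsTop s.Ω (suppDomOfRecord F ν Kt s.Ω) j) (B₃ * δ j * (F.P Kt).eta j ^ 2) U₀) ∧
            ∀ j, j ≤ k → Node00.Sect2.CoDivSmallOn (Node00.Sect2.omegaBondsTop s.Ω (suppDomOfRecord F ν Kt s.Ω) j) (B₃ * δ j * (F.P Kt).eta j ^ 3) U₀ :=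
  exists_thm1LetterT_atLength_lamDatum_of_prop8StepCoPGridGB h1

/-- ★★ **THE SAME WITH THE RECORD's (7) ROW** `Node00.Sect2.DataSmall7PTop` (dag-n12-c's `h15T` binder VERBATIM at `bd (k) Ω := Node00.lamDatum F Kt k Ω`), by name from the V23 text:
`…exists_thm1LetterT_atLength_lamDatum_pTop_of_prop8StepCoPGridGB` at the text.  CONDITIONAL on the text (§2 discharges it). [cite: Balaban1985Variational, (3),(7) p.278, Thm 1 (6)–(8) pp.278–279, Prop. 8 p.304; Balaban1984PropagatorsII, (2.3) p.224; Balaban1985RegularSpaces, (1.3)–(1.6) p.77; Balaban1988Convergent, (2.1) p.254, (2.5) p.255, (2.12) p.256, (2.18) p.257; Balaban1987RG1, (0.1) p.251] -/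
theorem exists_thm1LetterT_atLength_lamDatum_pTop_of_prop8StepCoPGridGBAt (h1 : Prop8StepCoPGridGBAt F) :
    ∃ (c c₀ c₁ : ℕ) (B₃ a₀ a₁ : ℝ), 2 * (F.L : ℝ) ^ 2 ≤ B₃ ∧ 0 < a₀ ∧ 0 < a₁ ∧
    ∀ (ν : Stage7Numerics) (Kt k : ℕ), c ≤ ν.M₁ → k + c₀ ≤ F.m + Kt → F.L ^ c₁ ∣ ν.M₁ → side (F.P Kt).L ν.M₁ k ∣ (F.P Kt).sitesPerDir 0 →
    ∀ (s : B14.Eq218Concrete.Seq (fun n : ℕ => Node00.unionsOfCubes (F.P Kt) (side (F.P Kt).L ν.M₁ n)) k),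
      Node00.Sect2.SeqSeparated ν.M₁ s → 0 < ν.M₁ →
      ∀ (ε₀ : ℝ) (δ : ℕ → ℝ), (∀ j, j ≤ k → 0 < δ j ∧ δ j ≤ a₁ ∧ B₃ * δ j ≤ ε₀) → (∀ j, j < k → δ j ≤ 2 * δ (j + 1)) →
      (∀ j, j < k → δ (j + 1) ≤ 2 * δ j) → ε₀ ≤ a₀ →
      ∀ W : MSField (F.P Kt) SU2,
        Node00.Sect2.DataSmall7PTop (Node00.avOfRecord F 2 Kt) s.Ω (suppDomOfRecord F ν Kt s.Ω) k δ W →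
        ∀ U₀ : GaugeField (F.P Kt) 0 SU2, IsMinimizerB (Node00.avOfRecord F 2 Kt)
            {U | (∀ j, j ≤ k → PlaqSmallOn (Node00.Sect2.omegaPlaqsTop s.Ω (suppDomOfRecord F ν Kt s.Ω) j) (ε₀ * (F.P Kt).eta j ^ 2) U) ∧
              Node00.Sect2.CoDivClassOnTop s.Ω (suppDomOfRecord F ν Kt s.Ω) k ε₀ U}
            (lamDatum F Kt k s.Ω) W U₀ →
          (∀ j, j ≤ k → PlaqSmallOn (Node00.Sect2.omegaPlaqsTop s.Ω (suppDomOfRecord F ν Kt s.Ω) j) (B₃ * δ j * (F.P Kt).eta j ^ 2) U₀) ∧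
            ∀ j, j ≤ k → Node00.Sect2.CoDivSmallOn (Node00.Sect2.omegaBondsTop s.Ω (suppDomOfRecord F ν Kt s.Ω) j) (B₃ * δ j * (F.P Kt).eta j ^ 3) U₀ :=
  exists_thm1LetterT_atLength_lamDatum_pTop_of_prop8StepCoPGridGB h1

/-! ## §2  Hypothesis-free: K0⁷'s V23 stub-1ᴮ text holds (`K0Stub1BHolds.prop8StepCoPGridGBAt_holds`) -/

/-- ★★★ **THE AT-LENGTH (8)-LETTER OF N12's (J0′) ROW AT PRINT's [II] (2.3) DATUM IS INHABITED, FOR EVERY FAMILY `F`** (print's (7) row `Node00.dataSmall7LamTopOf F 2`): §1 at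
dag-n07-e's hypothesis-free `K0Stub1BHolds.prop8StepCoPGridGBAt_holds F`.  A PRODUCER — no [15] sentence is a hypothesis of this theorem; its content is N07's S1c chain ([15] Prop. 8 at
print's datum) + 53′ + §1 of the green sibling; serves the instances passing K0⁷'s grid guard `A‴`. [cite: Balaban1985Variational, Thm 1 (6)–(8) pp.278–279, Prop. 8 p.304, (147)–(163) pp.301–304; Balaban1984PropagatorsII, (2.3) p.224; Balaban1985RegularSpaces, (1.3)–(1.6) p.77, Prop. 6 p.99; Balaban1988Convergent, (2.1) p.254, (2.5) p.255, (2.12) p.256, (2.17)–(2.18) p.257; Balaban1987RG1, (0.1) p.251] -/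
theorem exists_thm1LetterT_atLength_lamDatum_inhabited (F : T4Family) :
    ∃ (c c₀ c₁ : ℕ) (B₃ a₀ a₁ : ℝ), 2 * (F.L : ℝ) ^ 2 ≤ B₃ ∧ 0 < a₀ ∧ 0 < a₁ ∧
    ∀ (ν : Stage7Numerics) (Kt k : ℕ), c ≤ ν.M₁ → k + c₀ ≤ F.m + Kt → F.L ^ c₁ ∣ ν.M₁ → side (F.P Kt).L ν.M₁ k ∣ (F.P Kt).sitesPerDir 0 →
    ∀ (s : B14.Eq218Concrete.Seq (fun n : ℕ => Node00.unionsOfCubes (F.P Kt) (side (F.P Kt).L ν.M₁ n)) k),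
      Node00.Sect2.SeqSeparated ν.M₁ s → 0 < ν.M₁ →
      ∀ (ε₀ : ℝ) (δ : ℕ → ℝ), (∀ j, j ≤ k → 0 < δ j ∧ δ j ≤ a₁ ∧ B₃ * δ j ≤ ε₀) → (∀ j, j < k → δ j ≤ 2 * δ (j + 1)) →
      (∀ j, j < k → δ (j + 1) ≤ 2 * δ j) → ε₀ ≤ a₀ →
      ∀ W : MSField (F.P Kt) SU2, dataSmall7LamTopOf F 2 Kt s.Ω (suppDomOfRecord F ν Kt s.Ω) k δ W →
        ∀ U₀ : GaugeField (F.P Kt) 0 SU2, IsMinimizerB (Node00.avOfRecord F 2 Kt)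
            {U | (∀ j, j ≤ k → PlaqSmallOn (Node00.Sect2.omegaPlaqsTop s.Ω (suppDomOfRecord F ν Kt s.Ω) j) (ε₀ * (F.P Kt).eta j ^ 2) U) ∧
              Node00.Sect2.CoDivClassOnTop s.Ω (suppDomOfRecord F ν Kt s.Ω) k ε₀ U}
            (lamDatum F Kt k s.Ω) W U₀ →
          (∀ j, j ≤ k → PlaqSmallOn (Node00.Sect2.omegaPlaqsTop s.Ω (suppDomOfRecord F ν Kt s.Ω) j) (B₃ * δ j * (F.P Kt).eta j ^ 2) U₀) ∧
            ∀ j, j ≤ k → Node00.Sect2.CoDivSmallOn (Node00.Sect2.omegaBondsTop s.Ω (suppDomOfRecord F ν Kt s.Ω) j) (B₃ * δ j * (F.P Kt).eta j ^ 3) U₀ :=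
  exists_thm1LetterT_atLength_lamDatum_of_prop8StepCoPGridGBAt (prop8StepCoPGridGBAt_holds F)

/-- ★★★★ **THE SAME WITH THE RECORD's (7) ROW — dag-n12-c's `h15T` BINDER AT `bd (k) Ω := Node00.lamDatum F Kt k Ω`, INHABITED FOR EVERY FAMILY `F`** at every `(ν, Kt, k)` passing
K0⁷'s grid guard `A‴(c, c₀, c₁)` for the produced constants: the FIRST PRODUCER in the tree of a [15]-Theorem-1 letter of N12's (J0′) row at print's datum in the at-length knit's own
currency.  No [15] sentence is a hypothesis; content = N07's S1c chain + 53′ + the green sibling's §5. [cite: Balaban1985Variational, (3),(7) p.278, Thm 1 (6)–(8) pp.278–279, Prop. 8 p.304, (147)–(163) pp.301–304; Balaban1984PropagatorsII, (2.3) p.224; Balaban1985RegularSpaces, (1.3)–(1.6) p.77, Prop. 6 p.99; Balaban1988Convergent, (2.1) p.254, (2.5) p.255, (2.12) p.256, (2.17)–(2.18) p.257; Balaban1987RG1, (0.1) p.251; Balaban1989LargeFieldI, (1.74) p.192, Prop. 1 p.194] -/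
theorem exists_thm1LetterT_atLength_lamDatum_pTop_inhabited (F : T4Family) :
    ∃ (c c₀ c₁ : ℕ) (B₃ a₀ a₁ : ℝ), 2 * (F.L : ℝ) ^ 2 ≤ B₃ ∧ 0 < a₀ ∧ 0 < a₁ ∧
    ∀ (ν : Stage7Numerics) (Kt k : ℕ), c ≤ ν.M₁ → k + c₀ ≤ F.m + Kt → F.L ^ c₁ ∣ ν.M₁ → side (F.P Kt).L ν.M₁ k ∣ (F.P Kt).sitesPerDir 0 →
    ∀ (s : B14.Eq218Concrete.Seq (fun n : ℕ => Node00.unionsOfCubes (F.P Kt) (side (F.P Kt).L ν.M₁ n)) k),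
      Node00.Sect2.SeqSeparated ν.M₁ s → 0 < ν.M₁ →
      ∀ (ε₀ : ℝ) (δ : ℕ → ℝ), (∀ j, j ≤ k → 0 < δ j ∧ δ j ≤ a₁ ∧ B₃ * δ j ≤ ε₀) → (∀ j, j < k → δ j ≤ 2 * δ (j + 1)) →
      (∀ j, j < k → δ (j + 1) ≤ 2 * δ j) → ε₀ ≤ a₀ →
      ∀ W : MSField (F.P Kt) SU2,
        Node00.Sect2.DataSmall7PTop (Node00.avOfRecord F 2 Kt) s.Ω (suppDomOfRecord F ν Kt s.Ω) k δ W →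
        ∀ U₀ : GaugeField (F.P Kt) 0 SU2, IsMinimizerB (Node00.avOfRecord F 2 Kt)
            {U | (∀ j, j ≤ k → PlaqSmallOn (Node00.Sect2.omegaPlaqsTop s.Ω (suppDomOfRecord F ν Kt s.Ω) j) (ε₀ * (F.P Kt).eta j ^ 2) U) ∧
              Node00.Sect2.CoDivClassOnTop s.Ω (suppDomOfRecord F ν Kt s.Ω) k ε₀ U}
            (lamDatum F Kt k s.Ω) W U₀ →
          (∀ j, j ≤ k → PlaqSmallOn (Node00.Sect2.omegaPlaqsTop s.Ω (suppDomOfRecord F ν Kt s.Ω) j) (B₃ * δ j * (F.P Kt).eta j ^ 2) U₀) ∧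
            ∀ j, j ≤ k → Node00.Sect2.CoDivSmallOn (Node00.Sect2.omegaBondsTop s.Ω (suppDomOfRecord F ν Kt s.Ω) j) (B₃ * δ j * (F.P Kt).eta j ^ 3) U₀ :=
  exists_thm1LetterT_atLength_lamDatum_pTop_of_prop8StepCoPGridGBAt (prop8StepCoPGridGBAt_holds F)

end Summit.QuantumFields.YangMills.BalabanUVNodes.N12Thm1LetterAtLengthLamDatumInhabited

end
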